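import Literature.NumberTheory.EllipticCurves.TwoVariableTowerPrimeToPImageProofs
import Literature.NumberTheory.EllipticCurves.SerreOpenImageSupersingularInertiaProofs
import Literature.NumberTheory.EllipticCurves.DivisionFieldReducibleBorelKernel
import Literature.NumberTheory.EllipticCurves.GreenbergSelmer
import Literature.NumberTheory.GaloisRepresentations.DecompositionGroupOfCompletion
import HarnessLib

/-!
# Serre's Prop. 12 ⟹ no `p`-torsion fixed by inertia: a subgroup of `Γ_F` acting on `E[p]` through a
# cyclic group of order `p² − 1` fixes no non-zero point of `E[p^∞]`; the `ℤ_p²`-tower form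
# `E[p^∞]^{Gal(K̄/K̃_∞) ⊓ I_v̄} = 0`

`Proofs` file (theorems only). J.-P. Serre, *Propriétés galoisiennes des points d'ordre fini des courbes
elliptiques*, Invent. Math. 15 (1972), §1.11 Prop. 12: at a place `v ∣ p` with `e = 1` of good
SUPERSINGULAR reduction the inertia group acts on `E[p]` through a cyclic group `C` of order `p² − 1`
("sous-groupe de Cartan non déployé"), in particular `E[p] ∖ 0` is ONE orbit and no non-zero point is
fixed. This file proves the consequence used by Iwasawa theory over the `ℤ_p²`-tower — the vanishing
`E[p^∞]^{Gal(K̄/K̃_∞) ⊓ I_v̄} = 0` (hypothesis (V) of the control/torsion reduction of stub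
`stub_torsionSS`, crux `AnticyclotomicEisensteinDivisibility`, BSD cell `bsd-ssimc`; Summits file
`…Theorems.SignedBaseChangeAcDivControlTorsion.stub_torsionSS_of_isTorsion_XAc_of_vanishing_of_away`) —
FROM the printed shape of Prop. 12 (c) for the local inertia group `I_v̄ ≤ Γ_K`, taken as a hypothesis
(`IsCyclic (I_v̄.map ρ̄) ∧ #(I_v̄.map ρ̄) = p² − 1`; the tree proves it over `ℚ`,
`isCyclic_and_card_inertia_map_of_dvd_frobeniusTrace`; over `K` at a degree-one place it is for a typer).

* §1 (any field `F`, `W/F`, `#E[p] = p²`): `smul_ne_self_of_orderOf_eq` — an element `τ ∈ Γ_F` with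
  `ρ̄(τ)` of order `p² − 1` fixes no non-zero `P ∈ E[p]` (a fixed `P` spans a stable line on which `τ`
  is trivial and on whose quotient it is a scalar `d ∈ 𝔽_pˣ`; then `τ^{p−1}` is unipotent and
  `τ^{p(p−1)} = 1` on `E[p]`, so `p² − 1 ∣ p(p − 1)` — absurd; verbatim the argument of the tree's
  `hasIrreducibleModPGaloisRep_of_dvd_frobeniusTrace` over `ℚ`, re-run over `F`);
  `eq_zero_of_forall_smul_eq_of_isCyclic_card` (subgroup form) and the `p`-primary form
  `primary_eq_zero_of_forall_smul_eq_of_isCyclic_card` (induction on the exponent).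
* §2 (number field `K`, `ℤ_p`-extensions `κ₁, κ₂`, a finite place `v̄`): **`primary_eq_zero_of_forall_
  pairKer_inf_inertia_smul_eq`** — if `ρ̄(I_v̄)` is cyclic of order `p² − 1` then every point of `E[p^∞]`
  fixed by `pairKer κ₁ κ₂ ⊓ I_v̄` is `0`: the image of `I_v̄ ⊓ Gal(K̄/K̃_∞)` equals that of `I_v̄`
  (`ZpExtension.map_inf_pairKer_eq_map_of_coprime`, `p ∤ p² − 1`, `I_v̄` closed).

References: [Serre1972] §1.11 Prop. 12; [SilvermanAEC2009] III.6.4 (b) (`#E[p] = p²`).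
-/

noncomputable section

open scoped Classical

open Field NumberField IsDedekindDomain WeierstrassCurve
open Literature.NumberTheory.GaloisRepresentations

universe u

namespace Literature.NumberTheory.EllipticCurves.InertiaFixedPoint

/-! ## §1 An element of order `p² − 1` on `E[p]` has no non-zero fixed point -/

section AnyField

variable {F : Type u} [Field F] {W : WeierstrassCurve F} {p : ℕ} [Fact p.Prime]

/-- `σ` acts on the quotient by a stable line by a scalar: if `σ Φ ⊆ Φ`, `#Φ = p`, `#E[p] = p²`, there is
`d : ℤ` with `σ • P - d • P ∈ Φ` for all `P` (the tree's `exists_smul_sub_zsmul_mem_of_stable` over `ℚ`,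
re-run over `F`). [folklore] -/
private theorem exists_smul_sub_zsmul_mem_of_stable {Φ : AddSubgroup (geomTorsion W (p : ℤ))}
    (hΦ : Nat.card Φ = p) (hE : Nat.card (geomTorsion W (p : ℤ)) = p ^ 2)
    {σ : absoluteGaloisGroup F} (hstab : ∀ P ∈ Φ, σ • P ∈ Φ) :
    ∃ d : ℤ, ∀ P : geomTorsion W (p : ℤ), σ • P - d • P ∈ Φ := by
  have hp : p.Prime := Fact.out
  haveI : Finite (geomTorsion W (p : ℤ)) :=
    Nat.finite_of_card_ne_zero (by rw [hE]; exact pow_ne_zero 2 hp.ne_zero)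
  have hq : Nat.card (geomTorsion W (p : ℤ) ⧸ Φ) = p := by
    have h := Φ.card_eq_card_quotient_mul_card_addSubgroup
    rw [hE, hΦ, pow_two] at h
    exact (Nat.eq_of_mul_eq_mul_right hp.pos h).symm
  have hΦtop : Φ ≠ ⊤ := fun h ↦ by
    have := hΦ; rw [h, AddSubgroup.card_top, hE, pow_two] at this
    exact absurd this (by nlinarith [hp.one_lt])
  obtain ⟨Q₀, hQ₀⟩ : ∃ Q₀ : geomTorsion W (p : ℤ), Q₀ ∉ Φ := by
    by_contra h
    push Not at h
    exact hΦtop (eq_top_iff.mpr fun x _ ↦ h x)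
  have hq0 : (QuotientAddGroup.mk Q₀ : geomTorsion W (p : ℤ) ⧸ Φ) ≠ 0 := fun h ↦
    hQ₀ ((QuotientAddGroup.eq_zero_iff Q₀).mp h)
  haveI : Finite (geomTorsion W (p : ℤ) ⧸ Φ) := Nat.finite_of_card_ne_zero (by rw [hq]; exact hp.ne_zero)
  have hgen : (⊤ : AddSubgroup (geomTorsion W (p : ℤ) ⧸ Φ)) =
      AddSubgroup.zmultiples (QuotientAddGroup.mk Q₀) := by
    have hle : AddSubgroup.zmultiples (QuotientAddGroup.mk Q₀ : geomTorsion W (p : ℤ) ⧸ Φ) ≤ ⊤ :=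
      le_top
    have hdvd : Nat.card (AddSubgroup.zmultiples (QuotientAddGroup.mk Q₀ : geomTorsion W (p : ℤ) ⧸ Φ))
        ∣ p := by
      have h := AddSubgroup.card_dvd_of_le hle
      rwa [AddSubgroup.card_top, hq] at h
    rcases (Nat.dvd_prime hp).mp hdvd with h1 | h2
    · exfalso
      have := AddSubgroup.eq_bot_of_card_eq _ h1
      rw [AddSubgroup.zmultiples_eq_bot] at this
      exact hq0 this
    · exact (AddSubgroup.eq_of_le_of_card_ge hle (by rw [h2, AddSubgroup.card_top, hq])).symm
  have hmemq : ∀ x : geomTorsion W (p : ℤ) ⧸ Φ,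
      x ∈ AddSubgroup.zmultiples (QuotientAddGroup.mk Q₀ : geomTorsion W (p : ℤ) ⧸ Φ) :=
    fun x ↦ hgen ▸ AddSubgroup.mem_top x
  obtain ⟨d, hd⟩ := AddSubgroup.mem_zmultiples_iff.mp (hmemq (QuotientAddGroup.mk (σ • Q₀)))
  have hd' : σ • Q₀ - d • Q₀ ∈ Φ := by
    rw [← QuotientAddGroup.eq_iff_sub_mem, QuotientAddGroup.mk_zsmul]; exact hd.symm
  refine ⟨d, fun P ↦ ?_⟩
  obtain ⟨a, ha⟩ := AddSubgroup.mem_zmultiples_iff.mp (hmemq (QuotientAddGroup.mk P))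
  have haP : P - a • Q₀ ∈ Φ := by
    rw [← QuotientAddGroup.eq_iff_sub_mem, QuotientAddGroup.mk_zsmul]; exact ha.symm
  have hcalc : σ • P - d • P =
      σ • (P - a • Q₀) + a • (σ • Q₀ - d • Q₀) - d • (P - a • Q₀) := by
    rw [smul_sub, show σ • (a • Q₀) = a • (σ • Q₀) from
      map_zsmul (DistribSMul.toAddMonoidHom _ σ) a Q₀, zsmul_sub, zsmul_sub, smul_smul,
      smul_smul, mul_comm a d]
    abel
  rw [hcalc]
  exact Φ.sub_mem (Φ.add_mem (hstab _ haP) (Φ.zsmul_mem hd' a)) (Φ.zsmul_mem haP d)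

omit [Fact p.Prime] in
/-- Iterating modulo a stable subgroup: `σⁿ • P - dⁿ • P ∈ Φ`. [folklore] -/
private theorem pow_smul_sub_pow_zsmul_mem {Φ : AddSubgroup (geomTorsion W (p : ℤ))}
    {σ : absoluteGaloisGroup F} (hstab : ∀ P ∈ Φ, σ • P ∈ Φ) {d : ℤ}
    (hd : ∀ P : geomTorsion W (p : ℤ), σ • P - d • P ∈ Φ) (n : ℕ) :
    ∀ P : geomTorsion W (p : ℤ), (σ ^ n) • P - (d ^ n) • P ∈ Φ := by
  induction n with
  | zero => intro P; rw [pow_zero, pow_zero, one_smul, one_smul, sub_self]; exact Φ.zero_mem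
  | succ n ih =>
    intro P
    have hcalc : (σ ^ (n + 1)) • P - (d ^ (n + 1)) • P =
        (σ ^ n) • (σ • P - d • P) + d • ((σ ^ n) • P - (d ^ n) • P) := by
      rw [pow_succ, mul_smul, smul_sub, show (σ ^ n) • (d • P) = d • ((σ ^ n) • P) from
        map_zsmul (DistribSMul.toAddMonoidHom _ (σ ^ n)) d P, zsmul_sub, smul_smul d (d ^ n),
        mul_comm d, ← pow_succ]
      abel
    rw [hcalc]
    refine Φ.add_mem ?_ (Φ.zsmul_mem (ih P) d)
    have hstabn : ∀ m : ℕ, ∀ Q ∈ Φ, (σ ^ m) • Q ∈ Φ := by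
      intro m
      induction m with
      | zero => intro Q hQ; rwa [pow_zero, one_smul]
      | succ m ihm => intro Q hQ; rw [pow_succ, mul_smul]; exact ihm _ (hstab Q hQ)
    exact hstabn n _ (hd P)

omit [Fact p.Prime] in
/-- A unipotent element has order dividing `p` on `E[p]`: if `g` fixes `Φ` pointwise and acts trivially
on `E[p]/Φ`, then `g^p` fixes `E[p]`. [folklore] -/
private theorem pow_prime_smul_eq_self_of_unipotent {Φ : AddSubgroup (geomTorsion W (p : ℤ))}
    {g : absoluteGaloisGroup F} (hfix : ∀ P ∈ Φ, g • P = P)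
    (hquot : ∀ P : geomTorsion W (p : ℤ), g • P - P ∈ Φ) (P : geomTorsion W (p : ℤ)) :
    (g ^ p) • P = P := by
  have hiter : ∀ m : ℕ, (g ^ m) • P = P + (m : ℤ) • (g • P - P) := by
    intro m
    induction m with
    | zero => rw [pow_zero, one_smul, Nat.cast_zero, zero_smul, add_zero]
    | succ m ih =>
      rw [pow_succ', mul_smul, ih, smul_add, show g • ((m : ℤ) • (g • P - P)) =
        (m : ℤ) • (g • (g • P - P)) from map_zsmul (DistribSMul.toAddMonoidHom _ g) _ _,
        hfix _ (hquot P), Nat.cast_succ, add_smul, one_smul]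
      abel
  rw [hiter p]
  have hp0 : ((p : ℕ) : ℤ) • (g • P - P) = 0 := by
    rw [← Subtype.coe_inj, AddSubgroupClass.coe_zsmul, ZeroMemClass.coe_zero]
    exact (Submodule.mem_torsionBy_iff _ _).mp (g • P - P).2
  rw [hp0, add_zero]

/-- **An element acting on `E[p]` with order `p² − 1` fixes no non-zero point of `E[p]`** (`#E[p] = p²`):
a fixed `P ≠ 0` spans a `τ`-stable line `Φ = ℤP` on which `τ = 1`; `τ` acts on `E[p]/Φ` by a scalar
`d ∈ 𝔽_pˣ` (`p ∣ d` would put `τ E[p] ⊆ Φ`, `p² ≤ p`); so `τ^{p−1}` is unipotent (Fermat), `τ^{p(p−1)}`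
is trivial on `E[p]`, and `p² − 1 ∣ p(p − 1)` — absurd. Serre: the image "est un groupe cyclique d'ordre
`p² − 1`", a non-split Cartan subgroup, which acts freely on `E_p ∖ {0}`.
[cite: Serre1972, §1.11 Prop. 12 c) and §2.1 b)] -/
theorem smul_ne_self_of_orderOf_eq (hE : Nat.card (geomTorsion W (p : ℤ)) = p ^ 2)
    {τ : absoluteGaloisGroup F} (hτ : orderOf (galoisRepTorsion W (p : ℤ) τ) = p ^ 2 - 1)
    {P : geomTorsion W (p : ℤ)} (hP0 : P ≠ 0) : τ • P ≠ P := by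
  intro hfixP
  have hp : p.Prime := Fact.out
  haveI : Finite (geomTorsion W (p : ℤ)) :=
    Nat.finite_of_card_ne_zero (by rw [hE]; exact pow_ne_zero 2 hp.ne_zero)
  have hptor : ∀ Q : geomTorsion W (p : ℤ), ((p : ℕ) : ℤ) • Q = 0 := fun Q ↦ by
    rw [← Subtype.coe_inj, AddSubgroupClass.coe_zsmul, ZeroMemClass.coe_zero]
    exact (Submodule.mem_torsionBy_iff _ _).mp Q.2
  -- the stable line `Φ = ℤ P`, of order `p`, fixed pointwise by `τ`
  set Φ : AddSubgroup (geomTorsion W (p : ℤ)) := AddSubgroup.zmultiples P with hΦdef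
  have hordP : addOrderOf P = p := by
    refine addOrderOf_eq_prime ?_ hP0
    have h := hptor P
    rwa [natCast_zsmul] at h
  have hΦ : Nat.card Φ = p := by rw [hΦdef, Nat.card_zmultiples, hordP]
  have hfix : ∀ Q ∈ Φ, τ • Q = Q := fun Q hQ ↦ by
    obtain ⟨m, rfl⟩ := AddSubgroup.mem_zmultiples_iff.mp hQ
    rw [show τ • (m • P) = m • (τ • P) from map_zsmul (DistribSMul.toAddMonoidHom _ τ) m P, hfixP]
  have hstab : ∀ Q ∈ Φ, τ • Q ∈ Φ := fun Q hQ ↦ by rw [hfix Q hQ]; exact hQ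
  obtain ⟨d, hd⟩ := exists_smul_sub_zsmul_mem_of_stable hΦ hE hstab
  -- `d` is prime to `p`
  have hdp : ¬ (p : ℤ) ∣ d := by
    rintro ⟨c, rfl⟩
    have hall : ∀ Q : geomTorsion W (p : ℤ), τ • Q ∈ Φ := fun Q ↦ by
      have h := hd Q
      rwa [mul_comm, mul_smul, hptor, smul_zero, sub_zero] at h
    have htop : Φ = ⊤ := by
      refine eq_top_iff.mpr fun Q _ ↦ ?_
      have := hall (τ⁻¹ • Q)
      rwa [smul_inv_smul] at this
    have := hΦ
    rw [htop, AddSubgroup.card_top, hE, pow_two] at this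
    exact absurd this (by nlinarith [hp.one_lt])
  -- Fermat: `d^{p-1} ≡ 1 (mod p)`
  have hpi : Prime (p : ℤ) := Nat.prime_iff_prime_int.mp hp
  have hfermat : ∀ Q : geomTorsion W (p : ℤ), (d ^ (p - 1)) • Q = Q := by
    intro Q
    have h1 : d ^ (p - 1) ≡ 1 [ZMOD p] :=
      Int.ModEq.pow_card_sub_one_eq_one hp ((hpi.coprime_iff_not_dvd.mpr hdp).symm)
    obtain ⟨c, hc⟩ := (Int.modEq_iff_dvd.mp h1.symm)
    have h2 : d ^ (p - 1) = 1 + (p : ℤ) * c := by linarith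
    rw [h2, add_smul, one_smul, mul_comm, mul_smul, hptor, smul_zero, add_zero]
  -- `τ^{p-1}` is unipotent, so `τ^{(p-1)p}` is trivial on `E[p]`
  have hfix' : ∀ Q ∈ Φ, (τ ^ (p - 1)) • Q = Q := by
    intro Q hQ
    induction (p - 1) with
    | zero => rw [pow_zero, one_smul]
    | succ n ih => rw [pow_succ, mul_smul, hfix Q hQ, ih]
  have hquot : ∀ Q : geomTorsion W (p : ℤ), (τ ^ (p - 1)) • Q - Q ∈ Φ := fun Q ↦ by
    have h := pow_smul_sub_pow_zsmul_mem hstab hd (p - 1) Q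
    rwa [hfermat Q] at h
  have htriv : ∀ Q : geomTorsion W (p : ℤ), (τ ^ ((p - 1) * p)) • Q = Q := fun Q ↦ by
    rw [pow_mul]; exact pow_prime_smul_eq_self_of_unipotent hfix' hquot Q
  have hone : galoisRepTorsion W (p : ℤ) (τ ^ ((p - 1) * p)) = 1 :=
    (galoisRepTorsion_eq_one_iff' W (p : ℤ) _).mpr htriv
  rw [map_pow] at hone
  have hdvd : p ^ 2 - 1 ∣ (p - 1) * p := hτ ▸ orderOf_dvd_of_pow_eq_one hone
  have hpos : 0 < (p - 1) * p := Nat.mul_pos (by have := hp.two_le; omega) hp.pos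
  have hle := Nat.le_of_dvd hpos hdvd
  have h2 := hp.two_le
  have : p ^ 2 - 1 > (p - 1) * p := by
    have : (p - 1) * p = p ^ 2 - p := by rw [pow_two, Nat.sub_mul, one_mul]
    rw [this]; omega
  omega

/-- **A subgroup `H ≤ Γ_F` acting on `E[p]` through a cyclic group of order `p² − 1` fixes no non-zero
point of `E[p]`** (`#E[p] = p²`): apply `smul_ne_self_of_orderOf_eq` to a `τ ∈ H` mapping to a
generator. [cite: Serre1972, §1.11 Prop. 12 c)] -/
theorem eq_zero_of_forall_smul_eq_of_isCyclic_card (hE : Nat.card (geomTorsion W (p : ℤ)) = p ^ 2)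
    {H : Subgroup (absoluteGaloisGroup F)}
    (hcyc : IsCyclic (H.map (galoisRepTorsion W (p : ℤ))))
    (hcard : Nat.card (H.map (galoisRepTorsion W (p : ℤ))) = p ^ 2 - 1)
    {P : geomTorsion W (p : ℤ)} (hP : ∀ h ∈ H, h • P = P) : P = 0 := by
  haveI := hcyc
  obtain ⟨g, hg⟩ := IsCyclic.exists_ofOrder_eq_natCard (α := H.map (galoisRepTorsion W (p : ℤ)))
  obtain ⟨τ, hτH, hτg⟩ := Subgroup.mem_map.mp g.2
  have hordτ : orderOf (galoisRepTorsion W (p : ℤ) τ) = p ^ 2 - 1 := by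
    rw [hτg, Subgroup.orderOf_coe, hg, hcard]
  by_contra hP0
  exact smul_ne_self_of_orderOf_eq hE hordτ hP0 (hP τ hτH)

/-- **`p`-primary form: such an `H` fixes no non-zero point of `E[p^∞]`** (induction on the exponent:
if `p^{k+1} x = 0` and `H` fixes `x` then `p^k x ∈ E[p]^H = 0`). [cite: Serre1972, §1.11 Prop. 12 c)] -/
theorem primary_eq_zero_of_forall_smul_eq_of_isCyclic_card
    (hE : Nat.card (geomTorsion W (p : ℤ)) = p ^ 2) {H : Subgroup (absoluteGaloisGroup F)}
    (hcyc : IsCyclic (H.map (galoisRepTorsion W (p : ℤ))))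
    (hcard : Nat.card (H.map (galoisRepTorsion W (p : ℤ))) = p ^ 2 - 1)
    {m : geomPrimaryTorsion W p} (hm : ∀ h ∈ H, h • m = m) : m = 0 := by
  -- on geometric points: `p^k x = 0 ∧ H x = x ⟹ x = 0`
  have key : ∀ (k : ℕ) (x : geomPoints W), p ^ k • x = 0 → (∀ h ∈ H, h • x = x) → x = 0 := by
    intro k
    induction k with
    | zero => intro x hx _; rwa [pow_zero, one_smul] at hx
    | succ k ih =>
      intro x hx hHx
      have hPmem : p ^ k • x ∈ geomTorsion W (p : ℤ) := by
        refine (Submodule.mem_torsionBy_iff ((p : ℕ) : ℤ) (p ^ k • x)).mpr ?_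
        rw [natCast_zsmul, ← mul_smul, ← pow_succ', hx]
      have hPfix : ∀ h ∈ H, h • (⟨p ^ k • x, hPmem⟩ : geomTorsion W (p : ℤ)) = ⟨p ^ k • x, hPmem⟩ :=
        fun h hh ↦ Subtype.ext (by
          change h • (p ^ k • x) = p ^ k • x
          have e : h • (p ^ k • x) = p ^ k • (h • x) :=
            map_nsmul (DistribSMul.toAddMonoidHom _ h) (p ^ k) x
          rw [e, hHx h hh])
      have hP0 := eq_zero_of_forall_smul_eq_of_isCyclic_card hE hcyc hcard hPfix
      have hpk : p ^ k • x = 0 := congrArg Subtype.val hP0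
      exact ih x hpk hHx
  obtain ⟨n, hn⟩ := m.2
  have h := key n (m : geomPoints W) hn fun h hh ↦ by
    rw [← primaryComponent.coe_smul, hm h hh]
  exact Subtype.ext h

end AnyField

/-! ## §2 The `ℤ_p²`-tower: `E[p^∞]^{Gal(K̄/K̃_∞) ⊓ I_v̄} = 0` from Prop. 12 (c) for `I_v̄` -/

section Tower

variable {K : Type u} [Field K] [NumberField K] (W : WeierstrassCurve K) [W.IsElliptic]
  {p : ℕ} [Fact p.Prime] (κ₁ κ₂ : ZpExtension K p) (vbar : HeightOneSpectrum (𝓞 K))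

/-- The tree's chosen inertia group `I_v = GreenbergSelmer.inertia v` is closed in `Γ_K` (it is the
inertia group `I_{𝔓₀}` of `𝔓₀ = adicCompletionPrime K v`, `absIntegers.isClosed_inertia_holds`).
[cite: NeukirchANT1999, Ch. II §9 remark after (9.3)] -/
theorem isClosed_inertia : IsClosed ((GreenbergSelmer.inertia vbar : Subgroup (absoluteGaloisGroup K)) :
    Set (absoluteGaloisGroup K)) := by
  have e : GreenbergSelmer.inertia vbar = (adicCompletionPrime K vbar).inertia (absoluteGaloisGroup K) :=
    (inertia_adicCompletionPrime_eq_map_absInertia K vbar).symm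
  rw [e]
  exact absIntegers.isClosed_inertia_holds (R := 𝓞 K) (K := K) (adicCompletionPrime K vbar)

/-- **`E[p^∞]^{Gal(K̄/K̃_∞) ⊓ I_v̄} = 0` from Serre's Prop. 12 (c) for `I_v̄`.** For an elliptic curve
`W` over a number field `K`, `ℤ_p`-extensions `κ₁, κ₂` and a finite place `v̄`: if the local inertia
group `I_v̄ ≤ Γ_K` acts on `E[p]` through a CYCLIC group of order `p² − 1` (Prop. 12 (c): good
supersingular reduction at `v̄`, `e(v̄ ∣ p) = 1` — a hypothesis here), then no non-zero point of
`E[p^∞]` is fixed by `pairKer κ₁ κ₂ ⊓ I_v̄`: the image of `I_v̄ ⊓ Gal(K̄/K̃_∞)` in `Aut(E[p])` is all of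
`ρ̄(I_v̄)` (`p ∤ p² − 1`, `ZpExtension.map_inf_pairKer_eq_map_of_coprime`), which fixes nothing
(`primary_eq_zero_of_forall_smul_eq_of_isCyclic_card`, `#E[p] = p²` in characteristic `0`). This is the
vanishing input (V) of `…SignedBaseChangeAcDivControlTorsion.stub_torsionSS_of_isTorsion_XAc_of_vanishing_of_away`.
[cite: Serre1972, §1.11 Prop. 12 c)] -/
theorem primary_eq_zero_of_forall_pairKer_inf_inertia_smul_eq
    (hcyc : IsCyclic ((GreenbergSelmer.inertia vbar).map (galoisRepTorsion W (p : ℤ))))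
    (hcard : Nat.card ((GreenbergSelmer.inertia vbar).map (galoisRepTorsion W (p : ℤ))) = p ^ 2 - 1)
    {m : geomPrimaryTorsion W p}
    (hm : ∀ t ∈ ZpExtension.pairKer κ₁ κ₂ ⊓ GreenbergSelmer.inertia vbar, t • m = m) : m = 0 := by
  have hp : p.Prime := Fact.out
  have hE : Nat.card (geomTorsion W (p : ℤ)) = p ^ 2 := natCard_geomTorsion_eq_sq_of_charZero (W := W) hp
  -- `p ∤ p² - 1`
  have hcop : (Nat.card ((GreenbergSelmer.inertia vbar).map (galoisRepTorsion W (p : ℤ)))).Coprime p := by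
    rw [hcard]
    have h4 : 1 ≤ p ^ 2 := Nat.one_le_pow _ _ hp.pos
    refine (Nat.coprime_comm.mp ((Nat.Prime.coprime_iff_not_dvd hp).mpr fun hdvd ↦ ?_))
    have h1 : p ∣ p ^ 2 := dvd_pow_self p two_ne_zero
    have h2 : p ∣ p ^ 2 - (p ^ 2 - 1) := Nat.dvd_sub h1 hdvd
    rw [Nat.sub_sub_self h4] at h2
    exact hp.one_lt.ne' (Nat.dvd_one.mp h2)
  haveI : Finite ((GreenbergSelmer.inertia vbar).map (galoisRepTorsion W (p : ℤ))) :=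
    Nat.finite_of_card_ne_zero (by rw [hcard]; have := hp.two_le; intro h; nlinarith [Nat.sub_eq_zero_iff_le.mp h])
  have himg := ZpExtension.map_inf_pairKer_eq_map_of_coprime κ₁ κ₂ (galoisRepTorsion W (p : ℤ))
    (isClosed_inertia vbar) hcop
  have hcyc' : IsCyclic ((GreenbergSelmer.inertia vbar ⊓ ZpExtension.pairKer κ₁ κ₂).map
      (galoisRepTorsion W (p : ℤ))) := by rw [himg]; exact hcyc
  have hcard' : Nat.card ((GreenbergSelmer.inertia vbar ⊓ ZpExtension.pairKer κ₁ κ₂).map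
      (galoisRepTorsion W (p : ℤ))) = p ^ 2 - 1 := by rw [himg]; exact hcard
  refine primary_eq_zero_of_forall_smul_eq_of_isCyclic_card hE hcyc' hcard' fun h hh ↦ hm h ?_
  rwa [inf_comm] at hh

end Tower

end Literature.NumberTheory.EllipticCurves.InertiaFixedPoint

end
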